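import Mathlib
import HarnessLib
import Summits.HubbardSuperconductivity.HubbardSuperconductivity.Theorems.ThermalWedgeTwSeededEnsembleEquivalenceRRectangles
import Summits.HubbardSuperconductivity.HubbardSuperconductivity.Theorems.WeakCouplingBCSWcbcsBcsConstructionSubadditiveLimit2D

/-!
# Route `ThermalWedge`, crux `TwSeededEnsembleEquivalenceR` (stmt-HubbardSuperconductivity-15581):
# thermodynamic limit of the free energy density of pair-sourced Hubbard squares (free boundary conditions)

Support file (`--supports stmt-HubbardSuperconductivity-15581`; no definition; the route file is NOT imported).
Fifth layer of the infrastructure for the registered stub `stub_sourcedPressureLimit`: from the row and column cuts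
of `…RRectangles.lean`, stacking (`log Z(kM,n) ≥ k log Z(M,n) - 2βckn`, `c = 2|t| + 4|h|`), squares
(`log Z(kM,kM) ≥ k² log Z(M,M) - 4βck²M`), growth (`log Z(L,L) ≥ log Z(M,M) + (L²-M²)(log z₀ - 4βc) - 4βcL`,
`M ≤ L`) and the volume bound feed Fekete's lemma along squares (`stub_subadditiveLimit2D`, reused verbatim) for
`a(L) = -log Z(L,L) + (log z₀ - 4βc)L²`: **`log Z_β(L+1, L+1)/(L+1)²` converges** (`twR_rect_logZ_density_tendsto`),
for every translation-invariant nearest-neighbour pair kernel `ω` with `‖ω‖ ≤ 1` and all real `β ≥ 0, t, U, μ, h`.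

Ruelle, *Statistical Mechanics: Rigorous Results* (1969) §2.2 (thermodynamic limit by sub-additivity). [folklore]
-/

set_option linter.dupNamespace false

noncomputable section

namespace Summit.HubbardSuperconductivity.HubbardSuperconductivity.Theorems

open Literature.MathematicalPhysics.QuantumLattice Literature.Barriers.HubbardSuperconductivity
  Literature.Probability.LatticeModels Matrix Finset HubbardWave0 WcbcsBoxTiling Filter
open scoped BigOperators Matrix.Norms.L2Operator Topology

section RectLimit

variable (ω : (Fin 2 → ℤ) → ℂ)

/-- **Stacking rows**: `log Z_β(kM, n) ≥ k·log Z_β(M, n) - k·β(2|t|+4|h|)·2n`. [folklore] -/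
theorem twR_rect_rows_lower (hω₁ : ∀ v, ‖ω v‖ ≤ 1) (hωadj : ∀ a b : Fin 2 → ℤ, ω (b - a) ≠ 0 → (zdGraph 2).Adj a b) (M n : ℕ) {β : ℝ} (hβ : 0 ≤ β) (t U μ h : ℝ) : ∀ k : ℕ,
    (k : ℝ) * Real.log (partitionFn β (hamiltonianWith ((zdGraph 2).comap (fun p : (Lex (Fin M × Fin n)) => ![((ofLex p).1 : ℤ), ((ofLex p).2 : ℤ)])) t U μ - (h : ℂ) • ((∑ z : (Lex (Fin M × Fin n)) × (Lex (Fin M × Fin n)), (fun z : (Lex (Fin M × Fin n)) × (Lex (Fin M × Fin n)) => ω (![((ofLex z.2).1 : ℤ), ((ofLex z.2).2 : ℤ)] - ![((ofLex z.1).1 : ℤ), ((ofLex z.1).2 : ℤ)])) z • bondPair z.1 z.2) + (∑ z : (Lex (Fin M × Fin n)) × (Lex (Fin M × Fin n)), (fun z : (Lex (Fin M × Fin n)) × (Lex (Fin M × Fin n)) => ω (![((ofLex z.2).1 : ℤ), ((ofLex z.2).2 : ℤ)] - ![((ofLex z.1).1 : ℤ), ((ofLex z.1).2 : ℤ)]))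 z • bondPair z.1 z.2)ᴴ))).re - k * (β * ((2 * |t| + 4 * |h|) * (2 * n))) ≤ Real.log (partitionFn β (hamiltonianWith ((zdGraph 2).comap (fun p : (Lex (Fin (k * M) × Fin n)) => ![((ofLex p).1 : ℤ), ((ofLex p).2 : ℤ)])) t U μ - (h : ℂ) • ((∑ z : (Lex (Fin (k * M) × Fin n)) × (Lex (Fin (k * M) × Fin n)), (fun z : (Lex (Fin (k * M) × Fin n)) × (Lex (Fin (k * M) × Fin n)) => ω (![((ofLex z.2).1 : ℤ), ((ofLex z.2).2 : ℤ)] - ![((ofLex z.1).1 : ℤ), ((ofLex z.1).2 : ℤ)])) z • bondPair z.1 z.2) + (∑ z : (Lex (Fin (k * M) × Fin n)) × (Lex (Fin (k * M) × Fin n)), (fun z : (Lex (Fin (k * M) × Fin n)) × (Lex (Fin (k * M) × Fin n)) => ω (![((ofLex z.2).1 : ℤ), ((ofLex z.2).2 : ℤ)] - ![((ofLex z.1).1 : ℤ), ((ofLex z.1).2 : ℤ)])) z • bondPair z.1 z.2)ᴴ))).re := by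
  intro k
  induction k with
  | zero =>
      have h0 := twR_rect_abs_log_sub_le ω hω₁ hωadj (0 * M) n hβ t U μ h
      set X := Real.log (partitionFn β (hamiltonianWith ((zdGraph 2).comap (fun p : (Lex (Fin (0 * M) × Fin n)) => ![((ofLex p).1 : ℤ), ((ofLex p).2 : ℤ)])) t U μ - (h : ℂ) • ((∑ z : (Lex (Fin (0 * M) × Fin n)) × (Lex (Fin (0 * M) × Fin n)), (fun z : (Lex (Fin (0 * M) × Fin n)) × (Lex (Fin (0 * M) × Fin n)) => ω (![((ofLex z.2).1 : ℤ), ((ofLex z.2).2 : ℤ)] - ![((ofLex z.1).1 : ℤ), ((ofLex z.1).2 : ℤ)])) z • bondPair z.1 z.2) + (∑ z : (Lex (Fin (0 * M) × Fin n)) × (Lex (Fin (0 * M) × Fin n)), (fun z : (Lex (Fin (0 * M) × Fin n)) × (Lex (Fin (0 * M) × Fin n)) => ω (![((ofLex z.2).1 : ℤ), ((ofLex z.2).2 : ℤ)] - ![((ofLex z.1).1 : ℤ), ((ofLex z.1).2 : ℤ)])) z • bondPair z.1 z.2)ᴴ))).re with hXdef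
      have hz : ((0 * M * n : ℕ) : ℝ) = 0 := by push_cast; ring
      rw [hz] at h0
      have hX0 : X = 0 := abs_nonpos_iff.1 (by simpa using h0)
      rw [hX0]
      push_cast
      linarith
  | succ k ih =>
      have hcut := twR_rect_rowCut ω hω₁ hωadj (Nat.succ_mul k M).symm n hβ t U μ h
      rw [abs_le] at hcut
      push_cast
      linarith [hcut.1, ih]

/-- **Stacking columns**: `log Z_β(m, kM) ≥ k·log Z_β(m, M) - k·β(2|t|+4|h|)·2m`. [folklore] -/
theorem twR_rect_cols_lower (hω₁ : ∀ v, ‖ω v‖ ≤ 1) (hωadj : ∀ a b : Fin 2 → ℤ, ω (b - a) ≠ 0 → (zdGraph 2).Adj a b) (m M : ℕ) {β : ℝ} (hβ : 0 ≤ β) (t U μ h : ℝ) : ∀ k : ℕ,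
    (k : ℝ) * Real.log (partitionFn β (hamiltonianWith ((zdGraph 2).comap (fun p : (Lex (Fin m × Fin M)) => ![((ofLex p).1 : ℤ), ((ofLex p).2 : ℤ)])) t U μ - (h : ℂ) • ((∑ z : (Lex (Fin m × Fin M)) × (Lex (Fin m × Fin M)), (fun z : (Lex (Fin m × Fin M)) × (Lex (Fin m × Fin M)) => ω (![((ofLex z.2).1 : ℤ), ((ofLex z.2).2 : ℤ)] - ![((ofLex z.1).1 : ℤ), ((ofLex z.1).2 : ℤ)])) z • bondPair z.1 z.2) + (∑ z : (Lex (Fin m × Fin M)) × (Lex (Fin m × Fin M)), (fun z : (Lex (Fin m × Fin M)) × (Lex (Fin m × Fin M)) => ω (![((ofLex z.2).1 : ℤ), ((ofLex z.2).2 : ℤ)] - ![((ofLex z.1).1 : ℤ), ((ofLex z.1).2 : ℤ)])) z • bondPair z.1 z.2)ᴴ))).re - k * (β * ((2 * |t| + 4 * |h|) * (2 * m))) ≤ Real.log (partitionFn β (hamiltonianWith ((zdGraph 2).comap (fun p : (Lex (Fin m × Fin (k * M))) => ![((ofLex p).1 : ℤ), ((ofLex p).2 : ℤ)])) t U μ -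 (h : ℂ) • ((∑ z : (Lex (Fin m × Fin (k * M))) × (Lex (Fin m × Fin (k * M))), (fun z : (Lex (Fin m × Fin (k * M))) × (Lex (Fin m × Fin (k * M))) => ω (![((ofLex z.2).1 : ℤ), ((ofLex z.2).2 : ℤ)] - ![((ofLex z.1).1 : ℤ), ((ofLex z.1).2 : ℤ)])) z • bondPair z.1 z.2) + (∑ z : (Lex (Fin m × Fin (k * M))) × (Lex (Fin m × Fin (k * M))), (fun z : (Lex (Fin m × Fin (k * M))) × (Lex (Fin m × Fin (k * M))) => ω (![((ofLex z.2).1 : ℤ), ((ofLex z.2).2 : ℤ)] - ![((ofLex z.1).1 : ℤ), ((ofLex z.1).2 : ℤ)])) z • bondPair z.1 z.2)ᴴ))).re := by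
  intro k
  induction k with
  | zero =>
      have h0 := twR_rect_abs_log_sub_le ω hω₁ hωadj m (0 * M) hβ t U μ h
      set X := Real.log (partitionFn β (hamiltonianWith ((zdGraph 2).comap (fun p : (Lex (Fin m × Fin (0 * M))) => ![((ofLex p).1 : ℤ), ((ofLex p).2 : ℤ)])) t U μ - (h : ℂ) • ((∑ z : (Lex (Fin m × Fin (0 * M))) × (Lex (Fin m × Fin (0 * M))), (fun z : (Lex (Fin m × Fin (0 * M))) × (Lex (Fin m × Fin (0 * M))) => ω (![((ofLex z.2).1 : ℤ), ((ofLex z.2).2 : ℤ)] - ![((ofLex z.1).1 : ℤ), ((ofLex z.1).2 : ℤ)])) z • bondPair z.1 z.2) + (∑ z : (Lex (Fin m × Fin (0 * M))) × (Lex (Fin m × Fin (0 * M))), (fun z : (Lex (Fin m × Fin (0 * M))) × (Lex (Fin m × Fin (0 * M))) => ω (![((ofLex z.2).1 : ℤ), ((ofLex z.2).2 : ℤ)] - ![((ofLex z.1).1 : ℤ), ((ofLex z.1).2 : ℤ)])) z • bondPair z.1 z.2)ᴴ))).re with hXdef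
      have hz : ((m * (0 * M) : ℕ) : ℝ) = 0 := by push_cast; ring
      rw [hz] at h0
      have hX0 : X = 0 := abs_nonpos_iff.1 (by simpa using h0)
      rw [hX0]
      push_cast
      linarith
  | succ k ih =>
      have hcut := twR_rect_colCut ω hω₁ hωadj m (Nat.succ_mul k M).symm hβ t U μ h
      rw [abs_le] at hcut
      push_cast
      linarith [hcut.1, ih]

/-- **Squares from squares**: `log Z_β(kM, kM) ≥ k²·log Z_β(M, M) - 4β(2|t|+4|h|)k²M`. [folklore] -/
theorem twR_rect_squares_lower (hω₁ : ∀ v, ‖ω v‖ ≤ 1) (hωadj : ∀ a b : Fin 2 → ℤ, ω (b - a) ≠ 0 → (zdGraph 2).Adj a b) (M k : ℕ) {β : ℝ} (hβ : 0 ≤ β) (t U μ h : ℝ) :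
    (k : ℝ) ^ 2 * Real.log (partitionFn β (hamiltonianWith ((zdGraph 2).comap (fun p : (Lex (Fin M × Fin M)) => ![((ofLex p).1 : ℤ), ((ofLex p).2 : ℤ)])) t U μ - (h : ℂ) • ((∑ z : (Lex (Fin M × Fin M)) × (Lex (Fin M × Fin M)), (fun z : (Lex (Fin M × Fin M)) × (Lex (Fin M × Fin M)) => ω (![((ofLex z.2).1 : ℤ), ((ofLex z.2).2 : ℤ)] - ![((ofLex z.1).1 : ℤ), ((ofLex z.1).2 : ℤ)])) z • bondPair z.1 z.2) + (∑ z : (Lex (Fin M × Fin M)) × (Lex (Fin M × Fin M)), (fun z : (Lex (Fin M × Fin M)) × (Lex (Fin M × Fin M)) => ω (![((ofLex z.2).1 : ℤ), ((ofLex z.2).2 : ℤ)] - ![((ofLex z.1).1 : ℤ), ((ofLex z.1).2 : ℤ)])) z • bondPair z.1 z.2)ᴴ))).re - 4 * (β * (2 * |t| + 4 * |h|)) * (k : ℝ) ^ 2 * M ≤ Real.log (partitionFn β (hamiltonianWith ((zdGraph 2).comap (fun p : (Lex (Fin (k * M) × Fin (k * M))) => ![((ofLex p).1 : ℤ), ((ofLex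 p).2 : ℤ)])) t U μ - (h : ℂ) • ((∑ z : (Lex (Fin (k * M) × Fin (k * M))) × (Lex (Fin (k * M) × Fin (k * M))), (fun z : (Lex (Fin (k * M) × Fin (k * M))) × (Lex (Fin (k * M) × Fin (k * M))) => ω (![((ofLex z.2).1 : ℤ), ((ofLex z.2).2 : ℤ)] - ![((ofLex z.1).1 : ℤ), ((ofLex z.1).2 : ℤ)])) z • bondPair z.1 z.2) + (∑ z : (Lex (Fin (k * M) × Fin (k * M))) × (Lex (Fin (k * M) × Fin (k * M))), (fun z : (Lex (Fin (k * M) × Fin (k * M))) × (Lex (Fin (k * M) × Fin (k * M))) => ω (![((ofLex z.2).1 : ℤ), ((ofLex z.2).2 : ℤ)] - ![((ofLex z.1).1 : ℤ), ((ofLex z.1).2 : ℤ)])) z • bondPair z.1 z.2)ᴴ))).re := by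
  have h1 := twR_rect_rows_lower ω hω₁ hωadj M (k * M) hβ t U μ h k
  have h2 := twR_rect_cols_lower ω hω₁ hωadj M M hβ t U μ h k
  have hk : (0 : ℝ) ≤ k := Nat.cast_nonneg k
  have h3 := mul_le_mul_of_nonneg_left h2 hk
  push_cast at h1 h3 ⊢
  nlinarith [h1, h3]

/-- **Growth of squares**: for `L = M + D`,
`log Z_β(L, L) ≥ log Z_β(M, M) + (L² - M²)(log z₀ - 4β(2|t|+4|h|)) - 4β(2|t|+4|h|)L` (one row cut, one column cut
and the volume bound on the two left-over rectangles). [folklore] -/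
theorem twR_rect_growth_lower (hω₁ : ∀ v, ‖ω v‖ ≤ 1) (hωadj : ∀ a b : Fin 2 → ℤ, ω (b - a) ≠ 0 → (zdGraph 2).Adj a b) (M D : ℕ) {β : ℝ} (hβ : 0 ≤ β) (t U μ h : ℝ) :
    Real.log (partitionFn β (hamiltonianWith ((zdGraph 2).comap (fun p : (Lex (Fin M × Fin M)) => ![((ofLex p).1 : ℤ), ((ofLex p).2 : ℤ)])) t U μ - (h : ℂ) • ((∑ z : (Lex (Fin M × Fin M)) × (Lex (Fin M × Fin M)), (fun z : (Lex (Fin M × Fin M)) × (Lex (Fin M × Fin M)) => ω (![((ofLex z.2).1 : ℤ), ((ofLex z.2).2 : ℤ)] - ![((ofLex z.1).1 : ℤ), ((ofLex z.1).2 : ℤ)])) z • bondPair z.1 z.2) + (∑ z : (Lex (Fin M × Fin M)) × (Lex (Fin M × Fin M)), (fun z : (Lex (Fin M × Fin M)) × (Lex (Fin M × Fin M)) => ω (![((ofLex z.2).1 : ℤ), ((ofLex z.2).2 : ℤ)] - ![((ofLex z.1).1 : ℤ), ((ofLex z.1).2 : ℤ)])) z • bondPair z.1 z.2)ᴴ))).re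 + (((M + D : ℕ) : ℝ) ^ 2 - (M : ℝ) ^ 2) * (Real.log (atomicPartitionFnReal β U μ) - 4 * (β * (2 * |t| + 4 * |h|))) -
        4 * (β * (2 * |t| + 4 * |h|)) * ((M + D : ℕ) : ℝ) ≤ Real.log (partitionFn β (hamiltonianWith ((zdGraph 2).comap (fun p : (Lex (Fin (M + D) × Fin (M + D))) => ![((ofLex p).1 : ℤ), ((ofLex p).2 : ℤ)])) t U μ - (h : ℂ) • ((∑ z : (Lex (Fin (M + D) × Fin (M + D))) × (Lex (Fin (M + D) × Fin (M + D))), (fun z : (Lex (Fin (M + D) × Fin (M + D))) × (Lex (Fin (M + D) × Fin (M + D))) => ω (![((ofLex z.2).1 : ℤ), ((ofLex z.2).2 : ℤ)] - ![((ofLex z.1).1 : ℤ), ((ofLex z.1).2 : ℤ)])) z • bondPair z.1 z.2) + (∑ z : (Lex (Fin (M + D) × Fin (M + D))) × (Lex (Fin (M + D) × Fin (M + D))), (fun z : (Lex (Fin (M + D) × Fin (M + D))) × (Lex (Fin (M + D) × Fin (M + D))) => ω (![((ofLex z.2).1 : ℤ), ((ofLex z.2).2 : ℤ)] - ![((ofLex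 z.1).1 : ℤ), ((ofLex z.1).2 : ℤ)])) z • bondPair z.1 z.2)ᴴ))).re := by
  have hrow := twR_rect_rowCut ω hω₁ hωadj (rfl : M + D = M + D) (M + D) hβ t U μ h
  have hcol := twR_rect_colCut ω hω₁ hωadj M (rfl : M + D = M + D) hβ t U μ h
  have hv1 := twR_rect_abs_log_sub_le ω hω₁ hωadj D (M + D) hβ t U μ h
  have hv2 := twR_rect_abs_log_sub_le ω hω₁ hωadj M D hβ t U μ h
  rw [abs_le] at hrow hcol hv1 hv2
  have hc : 0 ≤ β * (2 * |t| + 4 * |h|) := by positivity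
  have hM : (0 : ℝ) ≤ M := Nat.cast_nonneg M
  have hD : (0 : ℝ) ≤ D := Nat.cast_nonneg D
  push_cast at hrow hcol hv1 hv2 ⊢
  nlinarith [hrow.1, hcol.1, hv1.1, hv2.1, hc, hM, hD, mul_nonneg hc hM, mul_nonneg hc hD]

/-- **Thermodynamic limit of the free-energy density of pair-sourced Hubbard squares** (free boundary conditions):
`log Z_β(L+1, L+1)/(L+1)²` converges as `L → ∞` (Fekete along squares, `stub_subadditiveLimit2D`, applied to
`a(L) = -log Z(L,L) + (log z₀ - 4β(2|t|+4|h|))L²`). [folklore] -/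
theorem twR_rect_logZ_density_tendsto (hω₁ : ∀ v, ‖ω v‖ ≤ 1) (hωadj : ∀ a b : Fin 2 → ℤ, ω (b - a) ≠ 0 → (zdGraph 2).Adj a b) {β : ℝ} (hβ : 0 ≤ β) (t U μ h : ℝ) :
    ∃ q : ℝ, Tendsto (fun L : ℕ => Real.log (partitionFn β (hamiltonianWith ((zdGraph 2).comap (fun p : (Lex (Fin (L + 1) × Fin (L + 1))) => ![((ofLex p).1 : ℤ), ((ofLex p).2 : ℤ)])) t U μ - (h : ℂ) • ((∑ z : (Lex (Fin (L + 1) × Fin (L + 1))) × (Lex (Fin (L + 1) × Fin (L + 1))), (fun z : (Lex (Fin (L + 1) × Fin (L + 1))) × (Lex (Fin (L + 1) × Fin (L + 1))) => ω (![((ofLex z.2).1 : ℤ), ((ofLex z.2).2 : ℤ)] - ![((ofLex z.1).1 : ℤ), ((ofLex z.1).2 : ℤ)])) z • bondPair z.1 z.2) + (∑ z : (Lex (Fin (L + 1) × Fin (L + 1))) × (Lex (Fin (L + 1) × Fin (L + 1))), (fun z : (Lex (Fin (L + 1) × Fin (L + 1))) × (Lex (Fin (L + 1) × Fin (L + 1)))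 => ω (![((ofLex z.2).1 : ℤ), ((ofLex z.2).2 : ℤ)] - ![((ofLex z.1).1 : ℤ), ((ofLex z.1).2 : ℤ)])) z • bondPair z.1 z.2)ᴴ))).re / ((L + 1 : ℕ) : ℝ) ^ 2) atTop (𝓝 q) := by
  set c := β * (2 * |t| + 4 * |h|) with hc
  have hc0 : 0 ≤ c := by positivity
  set κ := Real.log (atomicPartitionFnReal β U μ) - 4 * c with hκ
  set a : ℕ → ℝ := fun L => -Real.log (partitionFn β (hamiltonianWith ((zdGraph 2).comap (fun p : (Lex (Fin L × Fin L)) => ![((ofLex p).1 : ℤ), ((ofLex p).2 : ℤ)])) t U μ - (h : ℂ) • ((∑ z : (Lex (Fin L × Fin L)) × (Lex (Fin L × Fin L)), (fun z : (Lex (Fin L × Fin L)) × (Lex (Fin L × Fin L)) => ω (![((ofLex z.2).1 : ℤ), ((ofLex z.2).2 : ℤ)] - ![((ofLex z.1).1 : ℤ), ((ofLex z.1).2 : ℤ)])) z • bondPair z.1 z.2) + (∑ z : (Lex (Fin L × Fin L)) × (Lex (Fin L × Fin L)), (fun z : (Lex (Fin L × Fin L)) × (Lex (Fin L × Fin L))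 => ω (![((ofLex z.2).1 : ℤ), ((ofLex z.2).2 : ℤ)] - ![((ofLex z.1).1 : ℤ), ((ofLex z.1).2 : ℤ)])) z • bondPair z.1 z.2)ᴴ))).re + κ * (L : ℝ) ^ 2 with ha
  have h1 : ∀ L : ℕ, -(8 * c) * (L : ℝ) ^ 2 ≤ a L := by
    intro L
    have hv := twR_rect_abs_log_sub_le ω hω₁ hωadj L L hβ t U μ h
    rw [abs_le] at hv
    have hv2 := hv.2
    push_cast at hv2
    show -(8 * c) * (L : ℝ) ^ 2 ≤ -Real.log (partitionFn β (hamiltonianWith ((zdGraph 2).comap (fun p : (Lex (Fin L × Fin L)) => ![((ofLex p).1 : ℤ), ((ofLex p).2 : ℤ)])) t U μ - (h : ℂ) • ((∑ z : (Lex (Fin L × Fin L)) × (Lex (Fin L × Fin L)), (fun z : (Lex (Fin L × Fin L)) × (Lex (Fin L × Fin L)) => ω (![((ofLex z.2).1 : ℤ), ((ofLex z.2).2 : ℤ)] - ![((ofLex z.1).1 : ℤ), ((ofLex z.1).2 : ℤ)])) z • bondPair z.1 z.2) + (∑ z : (Lex (Fin L × Fin L)) × (Lex (Fin L × Fin L)),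 (fun z : (Lex (Fin L × Fin L)) × (Lex (Fin L × Fin L)) => ω (![((ofLex z.2).1 : ℤ), ((ofLex z.2).2 : ℤ)] - ![((ofLex z.1).1 : ℤ), ((ofLex z.1).2 : ℤ)])) z • bondPair z.1 z.2)ᴴ))).re + κ * (L : ℝ) ^ 2
    rw [hκ, hc]
    nlinarith [hv2]
  have h2 : ∀ k M : ℕ, a (k * M) ≤ (k : ℝ) ^ 2 * a M + (4 * c) * (k : ℝ) ^ 2 * M := by
    intro k M
    have hs := twR_rect_squares_lower ω hω₁ hωadj M k hβ t U μ h
    show -Real.log (partitionFn β (hamiltonianWith ((zdGraph 2).comap (fun p : (Lex (Fin (k * M) × Fin (k * M))) => ![((ofLex p).1 : ℤ), ((ofLex p).2 : ℤ)])) t U μ - (h : ℂ) • ((∑ z : (Lex (Fin (k * M) × Fin (k * M))) × (Lex (Fin (k * M) × Fin (k * M))), (fun z : (Lex (Fin (k * M) × Fin (k * M))) × (Lex (Fin (k * M) × Fin (k * M))) => ω (![((ofLex z.2).1 : ℤ), ((ofLex z.2).2 : ℤ)] - ![((ofLex z.1).1 : ℤ), ((ofLex z.1).2 : ℤ)]))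 z • bondPair z.1 z.2) + (∑ z : (Lex (Fin (k * M) × Fin (k * M))) × (Lex (Fin (k * M) × Fin (k * M))), (fun z : (Lex (Fin (k * M) × Fin (k * M))) × (Lex (Fin (k * M) × Fin (k * M))) => ω (![((ofLex z.2).1 : ℤ), ((ofLex z.2).2 : ℤ)] - ![((ofLex z.1).1 : ℤ), ((ofLex z.1).2 : ℤ)])) z • bondPair z.1 z.2)ᴴ))).re + κ * ((k * M : ℕ) : ℝ) ^ 2 ≤ (k : ℝ) ^ 2 * (-Real.log (partitionFn β (hamiltonianWith ((zdGraph 2).comap (fun p : (Lex (Fin M × Fin M)) => ![((ofLex p).1 : ℤ), ((ofLex p).2 : ℤ)])) t U μ - (h : ℂ) • ((∑ z : (Lex (Fin M × Fin M)) × (Lex (Fin M × Fin M)), (fun z : (Lex (Fin M × Fin M)) × (Lex (Fin M × Fin M)) => ω (![((ofLex z.2).1 : ℤ), ((ofLex z.2).2 : ℤ)] - ![((ofLex z.1).1 : ℤ), ((ofLex z.1).2 : ℤ)])) z • bondPair z.1 z.2) + (∑ z : (Lex (Fin M × Fin M)) × (Lex (Fin M × Fin M)), (fun z : (Lex (Fin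 M × Fin M)) × (Lex (Fin M × Fin M)) => ω (![((ofLex z.2).1 : ℤ), ((ofLex z.2).2 : ℤ)] - ![((ofLex z.1).1 : ℤ), ((ofLex z.1).2 : ℤ)])) z • bondPair z.1 z.2)ᴴ))).re + κ * (M : ℝ) ^ 2) + (4 * c) * (k : ℝ) ^ 2 * M
    rw [hc]
    push_cast
    nlinarith [hs]
  have h3 : ∀ L M : ℕ, M ≤ L → a L ≤ a M + (4 * c) * L := by
    intro L M hML
    obtain ⟨D, rfl⟩ := Nat.exists_eq_add_of_le hML
    have hg := twR_rect_growth_lower ω hω₁ hωadj M D hβ t U μ h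
    show -Real.log (partitionFn β (hamiltonianWith ((zdGraph 2).comap (fun p : (Lex (Fin (M + D) × Fin (M + D))) => ![((ofLex p).1 : ℤ), ((ofLex p).2 : ℤ)])) t U μ - (h : ℂ) • ((∑ z : (Lex (Fin (M + D) × Fin (M + D))) × (Lex (Fin (M + D) × Fin (M + D))), (fun z : (Lex (Fin (M + D) × Fin (M + D))) × (Lex (Fin (M + D) × Fin (M + D))) => ω (![((ofLex z.2).1 : ℤ), ((ofLex z.2).2 : ℤ)] - ![((ofLex z.1).1 : ℤ), ((ofLex z.1).2 : ℤ)])) z • bondPair z.1 z.2) + (∑ z : (Lex (Fin (M + D) × Fin (M + D))) × (Lex (Fin (M + D) × Fin (M + D))), (fun z : (Lex (Fin (M + D) × Fin (M + D))) × (Lex (Fin (M + D) × Fin (M + D))) => ω (![((ofLex z.2).1 : ℤ), ((ofLex z.2).2 : ℤ)] - ![((ofLex z.1).1 : ℤ), ((ofLex z.1).2 : ℤ)])) z • bondPair z.1 z.2)ᴴ))).re + κ * ((M + D : ℕ) : ℝ) ^ 2 ≤ (-Real.log (partitionFn β (hamiltonianWith ((zdGraph 2).comap (fun p : (Lex (Fin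 M × Fin M)) => ![((ofLex p).1 : ℤ), ((ofLex p).2 : ℤ)])) t U μ - (h : ℂ) • ((∑ z : (Lex (Fin M × Fin M)) × (Lex (Fin M × Fin M)), (fun z : (Lex (Fin M × Fin M)) × (Lex (Fin M × Fin M)) => ω (![((ofLex z.2).1 : ℤ), ((ofLex z.2).2 : ℤ)] - ![((ofLex z.1).1 : ℤ), ((ofLex z.1).2 : ℤ)])) z • bondPair z.1 z.2) + (∑ z : (Lex (Fin M × Fin M)) × (Lex (Fin M × Fin M)), (fun z : (Lex (Fin M × Fin M)) × (Lex (Fin M × Fin M)) => ω (![((ofLex z.2).1 : ℤ), ((ofLex z.2).2 : ℤ)] - ![((ofLex z.1).1 : ℤ), ((ofLex z.1).2 : ℤ)])) z • bondPair z.1 z.2)ᴴ))).re + κ * (M : ℝ) ^ 2) + (4 * c) * ((M + D : ℕ) : ℝ)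
    rw [hκ, hc]
    nlinarith [hg]
  obtain ⟨ℓ, hℓ⟩ := stub_subadditiveLimit2D a (4 * c) (8 * c) (by positivity) h1 h2 h3
  refine ⟨κ - ℓ, ?_⟩
  have hκlim : Tendsto (fun L : ℕ => κ - a (L + 1) / ((L + 1 : ℕ) : ℝ) ^ 2) atTop (𝓝 (κ - ℓ)) := tendsto_const_nhds.sub hℓ
  refine hκlim.congr' (Eventually.of_forall fun L => ?_)
  have hL : ((L + 1 : ℕ) : ℝ) ^ 2 ≠ 0 := by positivity
  show κ - (-Real.log (partitionFn β (hamiltonianWith ((zdGraph 2).comap (fun p : (Lex (Fin (L + 1) × Fin (L + 1))) => ![((ofLex p).1 : ℤ), ((ofLex p).2 : ℤ)])) t U μ - (h : ℂ) • ((∑ z : (Lex (Fin (L + 1) × Fin (L + 1))) × (Lex (Fin (L + 1) × Fin (L + 1))), (fun z : (Lex (Fin (L + 1) × Fin (L + 1))) × (Lex (Fin (L + 1) × Fin (L + 1))) => ω (![((ofLex z.2).1 : ℤ), ((ofLex z.2).2 : ℤ)] - ![((ofLex z.1).1 : ℤ), ((ofLex z.1).2 : ℤ)])) z • bondPair z.1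 z.2) + (∑ z : (Lex (Fin (L + 1) × Fin (L + 1))) × (Lex (Fin (L + 1) × Fin (L + 1))), (fun z : (Lex (Fin (L + 1) × Fin (L + 1))) × (Lex (Fin (L + 1) × Fin (L + 1))) => ω (![((ofLex z.2).1 : ℤ), ((ofLex z.2).2 : ℤ)] - ![((ofLex z.1).1 : ℤ), ((ofLex z.1).2 : ℤ)])) z • bondPair z.1 z.2)ᴴ))).re + κ * ((L + 1 : ℕ) : ℝ) ^ 2) / ((L + 1 : ℕ) : ℝ) ^ 2 = Real.log (partitionFn β (hamiltonianWith ((zdGraph 2).comap (fun p : (Lex (Fin (L + 1) × Fin (L + 1))) => ![((ofLex p).1 : ℤ), ((ofLex p).2 : ℤ)])) t U μ - (h : ℂ) • ((∑ z : (Lex (Fin (L + 1) × Fin (L + 1))) × (Lex (Fin (L + 1) × Fin (L + 1))), (fun z : (Lex (Fin (L + 1) × Fin (L + 1))) × (Lex (Fin (L + 1) × Fin (L + 1))) => ω (![((ofLex z.2).1 : ℤ), ((ofLex z.2).2 : ℤ)] - ![((ofLex z.1).1 : ℤ), ((ofLex z.1).2 : ℤ)])) z • bondPair z.1 z.2) +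 (∑ z : (Lex (Fin (L + 1) × Fin (L + 1))) × (Lex (Fin (L + 1) × Fin (L + 1))), (fun z : (Lex (Fin (L + 1) × Fin (L + 1))) × (Lex (Fin (L + 1) × Fin (L + 1))) => ω (![((ofLex z.2).1 : ℤ), ((ofLex z.2).2 : ℤ)] - ![((ofLex z.1).1 : ℤ), ((ofLex z.1).2 : ℤ)])) z • bondPair z.1 z.2)ᴴ))).re / ((L + 1 : ℕ) : ℝ) ^ 2
  field_simp
  ring

end RectLimit

/-! ### Summary (registered sub-goal of stmt-HubbardSuperconductivity-15581) -/

/-- **Registered sub-goal `twR_rectDensityLimit`** (infrastructure for `stub_sourcedPressureLimit`): the free-boundary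
thermodynamic limit of the free-energy density of pair-sourced Hubbard squares. [folklore] -/
theorem twR_rectDensityLimit : ∀ (ω : (Fin 2 → ℤ) → ℂ), (∀ v, ‖ω v‖ ≤ 1) → (∀ a b : Fin 2 → ℤ, ω (b - a) ≠ 0 → (Literature.Probability.LatticeModels.zdGraph 2).Adj a b) → ∀ (β t U μ h : ℝ), 0 ≤ β → ∃ q : ℝ, Filter.Tendsto (fun L : ℕ => Real.log (Matrix.partitionFn β (hamiltonianWith ((Literature.Probability.LatticeModels.zdGraph 2).comap (fun p : (Lex (Fin (L + 1) × Fin (L + 1))) => ![((ofLex p).1 : ℤ), ((ofLex p).2 : ℤ)])) t U μ - (h : ℂ) • ((∑ z : (Lex (Fin (L + 1) × Fin (L + 1))) × (Lex (Fin (L + 1) × Fin (L + 1))), (fun z : (Lex (Fin (L + 1) × Fin (L + 1))) × (Lex (Fin (L + 1) × Fin (L + 1))) => ω (![((ofLex z.2).1 : ℤ), ((ofLex z.2).2 : ℤ)] - ![((ofLex z.1).1 : ℤ), ((ofLex z.1).2 : ℤ)])) z • Literature.Barriers.HubbardSuperconductivity.bondPair z.1 z.2) + (∑ z : (Lex (Fin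 (L + 1) × Fin (L + 1))) × (Lex (Fin (L + 1) × Fin (L + 1))), (fun z : (Lex (Fin (L + 1) × Fin (L + 1))) × (Lex (Fin (L + 1) × Fin (L + 1))) => ω (![((ofLex z.2).1 : ℤ), ((ofLex z.2).2 : ℤ)] - ![((ofLex z.1).1 : ℤ), ((ofLex z.1).2 : ℤ)])) z • Literature.Barriers.HubbardSuperconductivity.bondPair z.1 z.2)ᴴ))).re / ((L + 1 : ℕ) : ℝ) ^ 2) Filter.atTop (nhds q) :=
  fun ω hω₁ hωadj _ t U μ h hβ => twR_rect_logZ_density_tendsto ω hω₁ hωadj hβ t U μ h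

end Summit.HubbardSuperconductivity.HubbardSuperconductivity.Theorems

end
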